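import Summits.CriticalPhenomena.PercolationContinuityZ3.Theorems.Transplant.PlanarSkeletonFrmFromDefs
import Summits.CriticalPhenomena.PercolationContinuityZ3.Theorems.Transplant.SkelFrmFromBParamsBridge0
import Summits.CriticalPhenomena.PercolationContinuityZ3.Theorems.Transplant.SkelFrmBParamsBridge0
import Summits.CriticalPhenomena.PercolationContinuityZ3.Theorems.Transplant.SkelFrmFromBChoiceLinks
import Summits.CriticalPhenomena.PercolationContinuityZ3.Theorems.Transplant.SkelFrmBChoiceLinks
import Summits.CriticalPhenomena.PercolationContinuityZ3.Theorems.Transplant.SkelFrmFrom1Normalise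
import Summits.CriticalPhenomena.PercolationContinuityZ3.Theorems.Transplant.SkelFrm1Normalise
import HarnessLib
import Summits.CriticalPhenomena.PercolationContinuityZ3.Theorems.Transplant.SkelFrmBChoiceBridge0
/-!
# U-WAVE PORT (RULING D-U, lead g21 2026-08-26; WAVE-U-MANIFEST v3.0 row «SkelFrmBChoiceBridge0» ↦ «SkelFrmFromBChoiceBridge0») of the tree module
# `Transplant/SkelFrmBChoiceBridge0` onto the carrier `PlanarSkeletonFrmFrom` (frames only, cylinders connected from width `ℓ₀` on)

ORIGINAL TITLE: N2 (frames-only node `SamePDropOfSkeletonFrm₁`, OPEN), (R) value layer — part ChoiceBridge0: **THE ROOT BRIDGE AT `AtQNQ`** —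

builds on p205010 (kernel theorem, internal audit signed; external expert review pending) — nothing in this file uses p205010; NOTHING is claimed about the
OPEN node U `SamePDropOfSkeletonFrmFrom₁` (nor U_s / the end state).  Lane `prim-bschramm`, seat `prim-hp-8 gen 53 (U-wave port pen, family P-hp8; tool of record = p3-g26 port_u.py)`; helper file
(`--supports stmt-CriticalPhenomena-4575 --as helper`).  PORT RULES r1–r4 of RULING D-U: declaration order and proof texts are those of the original,
byte-identical except (i) the carrier token `PlanarSkeletonFrm ↦ PlanarSkeletonFrmFrom` (binders, `namespace`/`end` lines, qualified names of twinned
declarations), (ii) carrier-FREE declarations of the original (φ-level `Skelφ…` blocks and namespace-only arithmetic residents) are NOT re-declared —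
this file imports the original and `export`s the twin-free residents (POLICY T / treatment (m1)); residents whose statement mentions a twinned
constant are copied, (iii) every carrier-binding declaration keeps its explicit binder `(Φ : PlanarSkeletonFrmFrom G)` in its own signature (r2).  Docstrings and citations are the original's.  Manifest row idx 118 (level 15; flags verbatim); filed by the hp-8 lineage under RULING M-11 (family P-hp8).
-/

noncomputable section

open scoped Classical

namespace Summit.CriticalPhenomena.PercolationContinuityZ3.Theorems.Transplant

open MeasureTheory Literature.Probability.Percolation Literature.Probability.LatticeModels SimpleGraph KNCells KNLevels
open Literature.Barriers.CriticalPhenomena (graphBall)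

namespace PlanarSkeletonFrmFrom

open SkelConc (Consts)
open Skelφ (oriφ trφ rootFrame pgSideHalfW pgramPrismFin)
open Skelφ.StepI (DataN DataNS OutNS)
open ChainPlanar (BridgePrm BridgeOK)

namespace NegB

open Neg

section Bridge0

variable {κ : Consts} {V : Type} [DecidableEq V] [Countable V] {G : SimpleGraph V} [G.LocallyFinite] {Φ : PlanarSkeletonFrmFrom G} {t : V} {p : unitInterval}
  {hC : Φ.CylSubcritical p} {gv fv : Neg.FSlot} {Pv : PSlot} {Sv : SSlot} {cv : CSlot} {bv : BSlot} {O : OutNS V} {q : unitInterval}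

/-! ## §1 Orientation, served sign, clause -/

/-- **THE ROOT BRIDGE READS THE LONG MAP**: `O.ori t MB0 nB0 = o_L` (both pairs are selected; `FactsNS.sel_ori`). [this work] -/
theorem ori_bridge0_eq_oL {κ : Consts} {V : Type} [DecidableEq V] [Countable V] {G : SimpleGraph V} [G.LocallyFinite] {Φ : PlanarSkeletonFrmFrom G} {t : V} {p : unitInterval} {hC : Φ.CylSubcritical p} {gv : Neg.FSlot} {fv : Neg.FSlot} {Pv : PSlot} {Sv : SSlot} {cv : CSlot} {bv : BSlot} {O : OutNS V} {q : unitInterval} (hAt : (choiceAtQ3 κ Φ t p Pv gv fv Sv cv bv hC).AtQNQ O q) (mk : ℕ) :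
    O.ori t (KS.MB0 κ Φ t p O.merged mk) (KS.nB0 κ Φ t p O.merged mk) = oL κ Φ t p O.D O.DT.toDataN O.ori (gOf κ Φ t p O gv) (fOf κ Φ t p O fv) :=
  Skelφ.StepI.OutNS.FactsNS.sel_ori hAt.1 _ _ _ _

/-- **Hence the bridge pair's oriented map IS `φL`.** [folklore] -/
theorem oriφ_bridge0_eq_φL {κ : Consts} {V : Type} [DecidableEq V] [Countable V] {G : SimpleGraph V} [G.LocallyFinite] {Φ : PlanarSkeletonFrmFrom G} {t : V} {p : unitInterval} {hC : Φ.CylSubcritical p} {gv : Neg.FSlot} {fv : Neg.FSlot} {Pv : PSlot} {Sv : SSlot} {cv : CSlot} {bv : BSlot} {O : OutNS V} {q : unitInterval} (hAt : (choiceAtQ3 κ Φ t p Pv gv fv Sv cv bv hC).AtQNQ O q) (mk : ℕ) :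
    oriφ Φ.φ (O.ori t (KS.MB0 κ Φ t p O.merged mk) (KS.nB0 κ Φ t p O.merged mk)) = φL κ Φ t p O.D O.DT.toDataN O.ori (gOf κ Φ t p O gv) (fOf κ Φ t p O fv) := by
  rw [ori_bridge0_eq_oL hAt mk]; rfl

/-- **The served near sign at the root bridge pair is `1`** (both families). [folklore] -/
theorem sgQ_bridge0_eq_one {κ : Consts} {V : Type} [DecidableEq V] [Countable V] {G : SimpleGraph V} [G.LocallyFinite] {Φ : PlanarSkeletonFrmFrom G} {t : V} {p : unitInterval} {hC : Φ.CylSubcritical p} {gv : Neg.FSlot} {fv : Neg.FSlot} {Pv : PSlot} {Sv : SSlot} {cv : CSlot} {bv : BSlot} {O : OutNS V} {q : unitInterval} (hAt : (choiceAtQ3 κ Φ t p Pv gv fv Sv cv bv hC).AtQNQ O q) (mk : ℕ) (fam : Fin 2) :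
    Skelφ.StepI.sgQ O.qd O.qdT O.ori t (KS.MB0 κ Φ t p O.merged mk) (KS.nB0 κ Φ t p O.merged mk) fam = 1 :=
  sgQ_sel_eq_one hAt _ _ fam

/-- **THE ROOT BRIDGE CLAUSE at `AtQNQ`**: the merged record's geometric clause at `(MB0, nB0)` for the map `φL`, and `|hB0| ≤ 10·nB0`. [this work] -/
theorem clauseB0_of_atQ3 {κ : Consts} {V : Type} [DecidableEq V] [Countable V] {G : SimpleGraph V} [G.LocallyFinite] {Φ : PlanarSkeletonFrmFrom G} {t : V} {p : unitInterval} {hC : Φ.CylSubcritical p} {gv : Neg.FSlot} {fv : Neg.FSlot} {Pv : PSlot} {Sv : SSlot} {cv : CSlot} {bv : BSlot} {O : OutNS V} {q : unitInterval} (hAt : (choiceAtQ3 κ Φ t p Pv gv fv Sv cv bv hC).AtQNQ O q) (mk : ℕ) :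
    O.merged.EqGeom G (φL κ Φ t p O.D O.DT.toDataN O.ori (gOf κ Φ t p O gv) (fOf κ Φ t p O fv)) t (KS.MB0 κ Φ t p O.merged mk) (KS.nB0 κ Φ t p O.merged mk) ∧
      (KS.hB0 κ Φ t p O.merged mk).natAbs ≤ 10 * KS.nB0 κ Φ t p O.merged mk := by
  have h := clauseP_of_atQ hAt (KS.bridge0_adm κ Φ t p O.merged mk).1 (KS.bridge0_adm κ Φ t p O.merged mk).2
  rw [oriφ_bridge0_eq_φL hAt mk] at h
  exact h

/-- The root bridge pair's numeric facts (ℤ shapes): `MB0 < nB0`, `MB0 < ℓB0`, `|vB0| ≤ nB0`, the layer inequality. [folklore] -/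
theorem eqNumB0_of_atQ3 {κ : Consts} {V : Type} [DecidableEq V] [Countable V] {G : SimpleGraph V} [G.LocallyFinite] {Φ : PlanarSkeletonFrmFrom G} {t : V} {p : unitInterval} {hC : Φ.CylSubcritical p} {gv : Neg.FSlot} {fv : Neg.FSlot} {Pv : PSlot} {Sv : SSlot} {cv : CSlot} {bv : BSlot} {O : OutNS V} {q : unitInterval} (hAt : (choiceAtQ3 κ Φ t p Pv gv fv Sv cv bv hC).AtQNQ O q) (mk : ℕ) :
    KS.MB0 κ Φ t p O.merged mk < KS.nB0 κ Φ t p O.merged mk ∧ KS.MB0 κ Φ t p O.merged mk < KS.ℓB0 κ Φ t p O.merged mk ∧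
      |KS.vB0 κ Φ t p O.merged mk| ≤ (KS.nB0 κ Φ t p O.merged mk : ℤ) ∧
      ((KS.MB0 κ Φ t p O.merged mk : ℤ) + 1) * ((KS.nB0 κ Φ t p O.merged mk : ℤ) + |KS.hB0 κ Φ t p O.merged mk|) ≤
        (KS.nB0 κ Φ t p O.merged mk : ℤ) * ((KS.ℓB0 κ Φ t p O.merged mk : ℤ) + 1) :=
  eqNumB_of_eqGeom t O.merged _ _ _ (clauseB0_of_atQ3 hAt mk).1

/-- **`2·b0 + 27 ≤ ℓB0` at `AtQNQ`** (so `3 ≤ ℓB0`, `27 ≤ ℓB0`). [folklore] -/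
theorem ℓB0_ge_of_atQ3 {κ : Consts} {V : Type} [DecidableEq V] [Countable V] {G : SimpleGraph V} [G.LocallyFinite] {Φ : PlanarSkeletonFrmFrom G} {t : V} {p : unitInterval} {hC : Φ.CylSubcritical p} {gv : Neg.FSlot} {fv : Neg.FSlot} {Pv : PSlot} {Sv : SSlot} {cv : CSlot} {bv : BSlot} {O : OutNS V} {q : unitInterval} (hAt : (choiceAtQ3 κ Φ t p Pv gv fv Sv cv bv hC).AtQNQ O q) (mk : ℕ) :
    2 * KS.b0 κ Φ t p O.merged mk + 27 ≤ KS.ℓB0 κ Φ t p O.merged mk :=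
  KS.ℓB0_ge κ Φ t p O.merged mk _ (clauseB0_of_atQ3 hAt mk).1

/-- **`hB` at `AtQNQ`**: the root bridge frame is admissible. [folklore] -/
theorem B0_ok_of_atQ3 {κ : Consts} {V : Type} [DecidableEq V] [Countable V] {G : SimpleGraph V} [G.LocallyFinite] {Φ : PlanarSkeletonFrmFrom G} {t : V} {p : unitInterval} {hC : Φ.CylSubcritical p} {gv : Neg.FSlot} {fv : Neg.FSlot} {Pv : PSlot} {Sv : SSlot} {cv : CSlot} {bv : BSlot} {O : OutNS V} {q : unitInterval} (hAt : (choiceAtQ3 κ Φ t p Pv gv fv Sv cv bv hC).AtQNQ O q) (mk : ℕ) :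
    BridgeOK (KS.B0 κ Φ t p O.merged mk (gOf κ Φ t p O gv) (fOf κ Φ t p O fv)) :=
  KS.B0_ok κ Φ t p O.merged mk _ _ (by have := ℓB0_ge_of_atQ3 hAt mk; omega)

/-- The zone at `M_u` lies in the cylinder of `φL` of radius `M_u` about its centre (nested fat seeds). [folklore] -/
theorem zone_subset_cyl_φL {κ : Consts} {V : Type} [DecidableEq V] [Countable V] {G : SimpleGraph V} [G.LocallyFinite] {Φ : PlanarSkeletonFrmFrom G} {t : V} {p : unitInterval} {hC : Φ.CylSubcritical p} {gv : Neg.FSlot} {fv : Neg.FSlot} {Pv : PSlot} {Sv : SSlot} {cv : CSlot} {bv : BSlot} {O : OutNS V} {q : unitInterval} (hAt : (choiceAtQ3 κ Φ t p Pv gv fv Sv cv bv hC).AtQNQ O q) (c : V) :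
    (↑(O.merged.Λ c (Mu O.merged)) : Set V) ⊆ Skelφ.cyl (φL κ Φ t p O.D O.DT.toDataN O.ori (gOf κ Φ t p O gv) (fOf κ Φ t p O fv)) c (Mu O.merged) := by
  obtain ⟨-, -, -, -, hΛeq⟩ := Skelφ.StepI.OutO.FactsO.seed hAt.1.factsO
  have hM : O.merged.Λ c (Mu O.merged) = Skelφ.fatSeq Φ.frame hC c (Mu O.merged) := by
    have := congrFun (congrFun hΛeq c) (Mu O.merged); exact this
  unfold NegB.φL
  rw [Skelφ.cyl_oriφ, hM]
  exact Skelφ.fatSeq_subset_cyl Φ.frame hC c _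

/-! ## §2 The readings of the bridge sets against `KS.B0` -/

/-- **`hQb`, `hFb` (and `hFZ`) FOR THE ROOT BRIDGE**: with `Qb c := pgramPrismFin G φL c nB0 hB0 (3ℓB0) RB0` and `Fb c := pgSideHalfW G φL c nB0 hB0 ℓB0 RB0 1 1`,
every `w ∈ Qb c` is within `RB0` of `c` and reads in `rootFrame φL t 1` inside `rootFrame c ± B0.pr`; every `w ∈ Fb c` is in `Qb c` and reads inside
`rootFrame c + [B0.dlo, B0.dhi]`; and `Fb c` misses the zone `Λ c M_u`. [cite: KozmaNitzan2024, §4 Lemma 10 Step IV] -/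
theorem bridge0Sets_of_atQ3 {κ : Consts} {V : Type} [DecidableEq V] [Countable V] {G : SimpleGraph V} [G.LocallyFinite] {Φ : PlanarSkeletonFrmFrom G} {t : V} {p : unitInterval} {hC : Φ.CylSubcritical p} {gv : Neg.FSlot} {fv : Neg.FSlot} {Pv : PSlot} {Sv : SSlot} {cv : CSlot} {bv : BSlot} {O : OutNS V} {q : unitInterval} (hAt : (choiceAtQ3 κ Φ t p Pv gv fv Sv cv bv hC).AtQNQ O q) (mk : ℕ) :
    (∀ c, ∀ w ∈ pgramPrismFin G (φL κ Φ t p O.D O.DT.toDataN O.ori (gOf κ Φ t p O gv) (fOf κ Φ t p O fv)) c (KS.nB0 κ Φ t p O.merged mk) (KS.hB0 κ Φ t p O.merged mk)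
        (3 * KS.ℓB0 κ Φ t p O.merged mk) (KS.RB0 κ Φ t p O.merged mk),
      w ∈ graphBall G c (KS.RB0 κ Φ t p O.merged mk) ∧
        rootFrame (φL κ Φ t p O.D O.DT.toDataN O.ori (gOf κ Φ t p O gv) (fOf κ Φ t p O fv)) t 1 w ∈
          Finset.Icc (rootFrame (φL κ Φ t p O.D O.DT.toDataN O.ori (gOf κ Φ t p O gv) (fOf κ Φ t p O fv)) t 1 c -
              (((KS.B0 κ Φ t p O.merged mk (gOf κ Φ t p O gv) (fOf κ Φ t p O fv)).pr : ℕ) : Site 2))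
            (rootFrame (φL κ Φ t p O.D O.DT.toDataN O.ori (gOf κ Φ t p O gv) (fOf κ Φ t p O fv)) t 1 c +
              (((KS.B0 κ Φ t p O.merged mk (gOf κ Φ t p O gv) (fOf κ Φ t p O fv)).pr : ℕ) : Site 2))) ∧
    (∀ c, ∀ w ∈ pgSideHalfW G (φL κ Φ t p O.D O.DT.toDataN O.ori (gOf κ Φ t p O gv) (fOf κ Φ t p O fv)) c (KS.nB0 κ Φ t p O.merged mk) (KS.hB0 κ Φ t p O.merged mk)
        (KS.ℓB0 κ Φ t p O.merged mk) (KS.RB0 κ Φ t p O.merged mk) 1 1,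
      w ∈ pgramPrismFin G (φL κ Φ t p O.D O.DT.toDataN O.ori (gOf κ Φ t p O gv) (fOf κ Φ t p O fv)) c (KS.nB0 κ Φ t p O.merged mk) (KS.hB0 κ Φ t p O.merged mk)
          (3 * KS.ℓB0 κ Φ t p O.merged mk) (KS.RB0 κ Φ t p O.merged mk) ∧
        rootFrame (φL κ Φ t p O.D O.DT.toDataN O.ori (gOf κ Φ t p O gv) (fOf κ Φ t p O fv)) t 1 w ∈
          Finset.Icc (rootFrame (φL κ Φ t p O.D O.DT.toDataN O.ori (gOf κ Φ t p O gv) (fOf κ Φ t p O fv)) t 1 c +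
              (KS.B0 κ Φ t p O.merged mk (gOf κ Φ t p O gv) (fOf κ Φ t p O fv)).dlo)
            (rootFrame (φL κ Φ t p O.D O.DT.toDataN O.ori (gOf κ Φ t p O gv) (fOf κ Φ t p O fv)) t 1 c +
              (KS.B0 κ Φ t p O.merged mk (gOf κ Φ t p O gv) (fOf κ Φ t p O fv)).dhi)) ∧
    (∀ c, Disjoint (pgSideHalfW G (φL κ Φ t p O.D O.DT.toDataN O.ori (gOf κ Φ t p O gv) (fOf κ Φ t p O fv)) c (KS.nB0 κ Φ t p O.merged mk) (KS.hB0 κ Φ t p O.merged mk)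
        (KS.ℓB0 κ Φ t p O.merged mk) (KS.RB0 κ Φ t p O.merged mk) 1 1) (O.merged.Λ c (Mu O.merged))) := by
  have hnb : 1 ≤ KS.nB0 κ Φ t p O.merged mk := by have := (eqNumB0_of_atQ3 hAt mk).1; omega
  have hMz : Mu O.merged < KS.nB0 κ Φ t p O.merged mk := lt_of_le_of_lt (KS.MB0_floors κ Φ t p O.merged mk).2.2 (KS.RF2_0 κ Φ t p O.merged mk).2.1
  have hℓ0 : (0 : ℤ) ≤ (KS.ℓB0 κ Φ t p O.merged mk : ℤ) := by positivity
  have hdlo : (KS.B0 κ Φ t p O.merged mk (gOf κ Φ t p O gv) (fOf κ Φ t p O fv)).dlo ≤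
      Skelφ.pt (KS.nB0 κ Φ t p O.merged mk) (1 * KS.hB0 κ Φ t p O.merged mk + min 0 (1 * (KS.ℓB0 κ Φ t p O.merged mk : ℤ))) := by
    have e : min 0 (1 * (KS.ℓB0 κ Φ t p O.merged mk : ℤ)) = 0 := by rw [one_mul]; exact min_eq_left hℓ0
    rw [e, add_zero]; exact le_of_eq rfl
  have hdhi : Skelφ.pt (KS.nB0 κ Φ t p O.merged mk) (1 * KS.hB0 κ Φ t p O.merged mk + max 0 (1 * (KS.ℓB0 κ Φ t p O.merged mk : ℤ))) ≤
      (KS.B0 κ Φ t p O.merged mk (gOf κ Φ t p O gv) (fOf κ Φ t p O fv)).dhi := by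
    have e : max 0 (1 * (KS.ℓB0 κ Φ t p O.merged mk : ℤ)) = KS.ℓB0 κ Φ t p O.merged mk := by rw [one_mul]; exact max_eq_right hℓ0
    rw [e]; exact le_of_eq rfl
  have key := fun c => Skelφ.bridgeSets_same (G := G) (φ := φL κ Φ t p O.D O.DT.toDataN O.ori (gOf κ Φ t p O gv) (fOf κ Φ t p O fv)) t (σ := 1) (Or.inl rfl)
    (KS.B0 κ Φ t p O.merged mk (gOf κ Φ t p O gv) (fOf κ Φ t p O fv)) (c := c) hnb (h := KS.hB0 κ Φ t p O.merged mk) (ℓ := KS.ℓB0 κ Φ t p O.merged mk)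
    (Rb := KS.RB0 κ Φ t p O.merged mk) (τ := 1) (Or.inl rfl) le_rfl hdlo hdhi (zone_subset_cyl_φL hAt c) hMz
  exact ⟨fun c => (key c).1, fun c => (key c).2.1, fun c => (key c).2.2⟩

/-! ## §3 The bridge event -/

/-- **`hbridge` FOR THE ROOT BRIDGE, LITERAL SHAPE**: at `Pv ⊇ Px0 mk`, for every `a ≥ δkit` and every centre `c`,
`1 − a³ < P_q(linkIn (pgramPrismFin G φL c nB0 hB0 (3ℓB0) RB0) (O.merged.Λ c (Mu O.merged)) (pgSideHalfW G φL c nB0 hB0 ℓB0 RB0 1 1))` — the extra pair's served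
side half (near sign `1` by `sgQ_sel_eq_one`, map `φL` by `sel_ori`), at the cube accuracy, zone lifted from the seed level to `M_u`. [cite: KozmaNitzan2024, §4 pp. 19–21] -/
theorem hbridge0_of_atQ3 {κ : Consts} {V : Type} [DecidableEq V] [Countable V] {G : SimpleGraph V} [G.LocallyFinite] {Φ : PlanarSkeletonFrmFrom G} {t : V} {p : unitInterval} {hC : Φ.CylSubcritical p} {gv : Neg.FSlot} {fv : Neg.FSlot} {Pv : PSlot} {Sv : SSlot} {cv : CSlot} {bv : BSlot} {O : OutNS V} {q : unitInterval} (hAt : (choiceAtQ3 κ Φ t p Pv gv fv Sv cv bv hC).AtQNQ O q) (h1 : Φ.types = {t}) (mk : ℕ)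
    (hPx : (KS.Px0 mk κ Φ t p O.merged).1 ⊆ (Pv κ Φ t p O.merged).1) {a : ℝ} (ha : Neg.δkit κ Φ ≤ a) :
    ∀ c : V, 1 - a ^ 3 < (bondPercolation G q).real
      (linkIn (↑(pgramPrismFin G (φL κ Φ t p O.D O.DT.toDataN O.ori (gOf κ Φ t p O gv) (fOf κ Φ t p O fv)) c (KS.nB0 κ Φ t p O.merged mk) (KS.hB0 κ Φ t p O.merged mk)
          (3 * KS.ℓB0 κ Φ t p O.merged mk) (KS.RB0 κ Φ t p O.merged mk)) : Set V)
        (O.merged.Λ c (Mu O.merged))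
        (pgSideHalfW G (φL κ Φ t p O.D O.DT.toDataN O.ori (gOf κ Φ t p O gv) (fOf κ Φ t p O fv)) c (KS.nB0 κ Φ t p O.merged mk) (KS.hB0 κ Φ t p O.merged mk)
          (KS.ℓB0 κ Φ t p O.merged mk) (KS.RB0 κ Φ t p O.merged mk) 1 1)) := by
  intro c
  have h := inputsExtraAt_of_atQ hAt h1 c (KS.mem_of_Px0_subset κ Φ t p O.merged mk Pv hPx) 0 1
  rw [oriφ_bridge0_eq_φL hAt mk, sgQ_bridge0_eq_one hAt mk 0, Skelφ.StepI.eventNAt_some] at h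
  unfold Skelφ.StepI.regionNAt Skelφ.StepI.pieceNAt at h
  rw [if_pos rfl, Units.val_one] at h
  rw [Skelφ.StepI.coe_pgramPrismFin]
  have hcube := δI3_le_cube_of_le κ Φ ha
  refine lt_of_le_of_lt (by linarith) (h.trans_le (measureReal_mono ?_ (measure_ne_top _ _)))
  exact linkIn_mono le_rfl (zone_k_subset_zone_Mu hAt c) subset_rfl

/-- **`hbridge` FOR THE ROOT BRIDGE, zone AT THE SEED LEVEL `k`** ((R-42): the successor skeletons `…Q3K…` wire the fat seed at level `k`; Step I‴ serves
the link there natively — this is `hbridge0_of_atQ3` without the `M_u` lift). [cite: KozmaNitzan2024, §4 pp. 19–21] -/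
theorem hbridge0K_of_atQ3 {κ : Consts} {V : Type} [DecidableEq V] [Countable V] {G : SimpleGraph V} [G.LocallyFinite] {Φ : PlanarSkeletonFrmFrom G} {t : V} {p : unitInterval} {hC : Φ.CylSubcritical p} {gv : Neg.FSlot} {fv : Neg.FSlot} {Pv : PSlot} {Sv : SSlot} {cv : CSlot} {bv : BSlot} {O : OutNS V} {q : unitInterval} (hAt : (choiceAtQ3 κ Φ t p Pv gv fv Sv cv bv hC).AtQNQ O q) (h1 : Φ.types = {t}) (mk : ℕ)
    (hPx : (KS.Px0 mk κ Φ t p O.merged).1 ⊆ (Pv κ Φ t p O.merged).1) {a : ℝ} (ha : Neg.δkit κ Φ ≤ a) :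
    ∀ c : V, 1 - a ^ 3 < (bondPercolation G q).real
      (linkIn (↑(pgramPrismFin G (φL κ Φ t p O.D O.DT.toDataN O.ori (gOf κ Φ t p O gv) (fOf κ Φ t p O fv)) c (KS.nB0 κ Φ t p O.merged mk) (KS.hB0 κ Φ t p O.merged mk)
          (3 * KS.ℓB0 κ Φ t p O.merged mk) (KS.RB0 κ Φ t p O.merged mk)) : Set V)
        (O.merged.Λ c O.merged.k)
        (pgSideHalfW G (φL κ Φ t p O.D O.DT.toDataN O.ori (gOf κ Φ t p O gv) (fOf κ Φ t p O fv)) c (KS.nB0 κ Φ t p O.merged mk) (KS.hB0 κ Φ t p O.merged mk)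
          (KS.ℓB0 κ Φ t p O.merged mk) (KS.RB0 κ Φ t p O.merged mk) 1 1)) := by
  intro c
  have h := inputsExtraAt_of_atQ hAt h1 c (KS.mem_of_Px0_subset κ Φ t p O.merged mk Pv hPx) 0 1
  rw [oriφ_bridge0_eq_φL hAt mk, sgQ_bridge0_eq_one hAt mk 0, Skelφ.StepI.eventNAt_some] at h
  unfold Skelφ.StepI.regionNAt Skelφ.StepI.pieceNAt at h
  rw [if_pos rfl, Units.val_one] at h
  rw [Skelφ.StepI.coe_pgramPrismFin]
  have hcube := δI3_le_cube_of_le κ Φ ha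
  exact lt_of_le_of_lt (by linarith) h

/-- **`hbridge` at level `k` at the root accuracy `κ.δr 0`** (the `…Q3K…` skeletons' literal binder). [folklore] -/
theorem hbridge0K_of_atQ3_δr {κ : Consts} {V : Type} [DecidableEq V] [Countable V] {G : SimpleGraph V} [G.LocallyFinite] {Φ : PlanarSkeletonFrmFrom G} {t : V} {p : unitInterval} {hC : Φ.CylSubcritical p} {gv : Neg.FSlot} {fv : Neg.FSlot} {Pv : PSlot} {Sv : SSlot} {cv : CSlot} {bv : BSlot} {O : OutNS V} {q : unitInterval} (hAt : (choiceAtQ3 κ Φ t p Pv gv fv Sv cv bv hC).AtQNQ O q) (h1 : Φ.types = {t}) (mk : ℕ)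
    (hPx : (KS.Px0 mk κ Φ t p O.merged).1 ⊆ (Pv κ Φ t p O.merged).1) :
    ∀ c : V, 1 - κ.δr 0 ^ 3 < (bondPercolation G q).real
      (linkIn (↑(pgramPrismFin G (φL κ Φ t p O.D O.DT.toDataN O.ori (gOf κ Φ t p O gv) (fOf κ Φ t p O fv)) c (KS.nB0 κ Φ t p O.merged mk) (KS.hB0 κ Φ t p O.merged mk)
          (3 * KS.ℓB0 κ Φ t p O.merged mk) (KS.RB0 κ Φ t p O.merged mk)) : Set V)
        (O.merged.Λ c O.merged.k)
        (pgSideHalfW G (φL κ Φ t p O.D O.DT.toDataN O.ori (gOf κ Φ t p O gv) (fOf κ Φ t p O fv)) c (KS.nB0 κ Φ t p O.merged mk) (KS.hB0 κ Φ t p O.merged mk)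
          (KS.ℓB0 κ Φ t p O.merged mk) (KS.RB0 κ Φ t p O.merged mk) 1 1)) :=
  hbridge0K_of_atQ3 hAt h1 mk hPx (Neg.δkit_le_δr κ Φ (n := 0) (by norm_num))

/-- **`hbridge` at the root accuracy `κ.δr 0`** (the skeletons' literal binder: `1 − (κ.δr 0)³ < …`). [folklore] -/
theorem hbridge0_of_atQ3_δr {κ : Consts} {V : Type} [DecidableEq V] [Countable V] {G : SimpleGraph V} [G.LocallyFinite] {Φ : PlanarSkeletonFrmFrom G} {t : V} {p : unitInterval} {hC : Φ.CylSubcritical p} {gv : Neg.FSlot} {fv : Neg.FSlot} {Pv : PSlot} {Sv : SSlot} {cv : CSlot} {bv : BSlot} {O : OutNS V} {q : unitInterval} (hAt : (choiceAtQ3 κ Φ t p Pv gv fv Sv cv bv hC).AtQNQ O q) (h1 : Φ.types = {t}) (mk : ℕ)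
    (hPx : (KS.Px0 mk κ Φ t p O.merged).1 ⊆ (Pv κ Φ t p O.merged).1) :
    ∀ c : V, 1 - κ.δr 0 ^ 3 < (bondPercolation G q).real
      (linkIn (↑(pgramPrismFin G (φL κ Φ t p O.D O.DT.toDataN O.ori (gOf κ Φ t p O gv) (fOf κ Φ t p O fv)) c (KS.nB0 κ Φ t p O.merged mk) (KS.hB0 κ Φ t p O.merged mk)
          (3 * KS.ℓB0 κ Φ t p O.merged mk) (KS.RB0 κ Φ t p O.merged mk)) : Set V)
        (O.merged.Λ c (Mu O.merged))
        (pgSideHalfW G (φL κ Φ t p O.D O.DT.toDataN O.ori (gOf κ Φ t p O gv) (fOf κ Φ t p O fv)) c (KS.nB0 κ Φ t p O.merged mk) (KS.hB0 κ Φ t p O.merged mk)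
          (KS.ℓB0 κ Φ t p O.merged mk) (KS.RB0 κ Φ t p O.merged mk) 1 1)) :=
  hbridge0_of_atQ3 hAt h1 mk hPx (Neg.δkit_le_δr κ Φ (n := 0) (by norm_num))

end Bridge0

end NegB

end PlanarSkeletonFrmFrom

end Summit.CriticalPhenomena.PercolationContinuityZ3.Theorems.Transplant

end
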